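import Mathlib
import Literature.LinearAlgebra.Matrix.SmithNormalFormValuationRing
import Literature.RepresentationTheory.AlgebraicGroups.ValuationMonomialBasis
import Literature.Combinatorics.Optimization.GordanAlternative
import HarnessLib

/-!
# Hilbert–Mumford for `SL_m(ℂ)³` on `3`-tensors, II: monomial Cartan decomposition and weights

Second file of the proof of `Kempf1978_thm14_tensor` (valuative method); theorems only, over an
arbitrary valued field `(L, O)`.

* `exists_monomial_cartan` — **monomial Cartan decomposition**: three matrices `Γ⁽ᵖ⁾ ∈ SL_ι(L)`
  factor as `Γ⁽ᵖ⁾ = P⁽ᵖ⁾ · diag(π^{n⁽ᵖ⁾_a})_a · Q⁽ᵖ⁾` with `P⁽ᵖ⁾, Q⁽ᵖ⁾ ∈ SL_ι(O)`, where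
  `π₁, …, π_r ∈ L^×` are valuation-independent (a monomial `π^k` is a unit of `O` only for
  `k = 0`), the exponent vectors `n⁽ᵖ⁾_a ∈ ℤ^r` sum to zero over `a` for each `p`
  (Smith normal form over `O`, then the monomial basis of the diagonal entries, the units being
  absorbed into `Q⁽ᵖ⁾`).
* `exists_sign_weights` — **integer weights with the right signs**: for valuation-independent
  `π` and finitely many exponent vectors `E_c`, there is `h ∈ ℤ^r` with `⟨h, E_c⟩ < 0` whenever
  `π^{E_c} ∉ O` and `⟨h, E_c⟩ > 0` whenever `π^{E_c}` is a non-unit of `O` (Gordan's alternative;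
  a nonnegative relation among these vectors would exhibit `1` as a product of elements of the
  maximal ideal).

These turn the Cartan decomposition of the generic point of `SL³` into an honest one-parameter
subgroup with integer weights (file III).
-/

noncomputable section

open Matrix
open scoped BigOperators

namespace Literature.RepresentationTheory.AlgebraicGroups

variable {L : Type*} [Field L] (O : ValuationSubring L)

/-! ### Products of integer powers -/

/-- `∏_a x ^ e_a = x ^ Σ_a e_a` for `x ≠ 0`. [folklore] -/
theorem prod_zpow_eq_zpow_sum {α : Type*} (s : Finset α) (x : L) (hx : x ≠ 0) (e : α → ℤ) :
    ∏ a ∈ s, x ^ e a = x ^ ∑ a ∈ s, e a := by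
  classical
  induction s using Finset.induction_on with
  | empty => simp
  | insert a s ha ih => rw [Finset.prod_insert ha, Finset.sum_insert ha, ih, zpow_add₀ hx]

/-- Monomials are multiplicative in the exponent vector: `π^{k + k'} = π^k · π^{k'}`. [folklore] -/
theorem prod_zpow_add {r : ℕ} (π : Fin r → L) (hπ : ∀ j, π j ≠ 0) (k k' : Fin r → ℤ) :
    (∏ j, π j ^ (k j + k' j)) = (∏ j, π j ^ k j) * ∏ j, π j ^ k' j := by
  rw [← Finset.prod_mul_distrib]
  exact Finset.prod_congr rfl fun j _ => zpow_add₀ (hπ j) _ _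

/-- `π^{Σ_a k_a} = ∏_a π^{k_a}` for exponent vectors. [folklore] -/
theorem prod_zpow_sum {r : ℕ} (π : Fin r → L) (hπ : ∀ j, π j ≠ 0) {α : Type*} (s : Finset α)
    (k : α → Fin r → ℤ) : (∏ j, π j ^ ∑ a ∈ s, k a j) = ∏ a ∈ s, ∏ j, π j ^ k a j := by
  classical
  induction s using Finset.induction_on with
  | empty => simp
  | insert a s ha ih =>
    rw [Finset.prod_insert ha, ← ih, ← prod_zpow_add π hπ]
    exact Finset.prod_congr rfl fun j _ => by rw [Finset.sum_insert ha]

/-! ### Monomial Cartan decomposition -/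

/-- **Monomial Cartan decomposition of three unimodular matrices.** `Γ⁽ᵖ⁾ ∈ SL_ι(L)` (`p ∈ Fin 3`)
factor as `P⁽ᵖ⁾ · diag(∏_j π_j^{n p a j})_a · Q⁽ᵖ⁾` with `P⁽ᵖ⁾, Q⁽ᵖ⁾` over `O` of determinant `1`,
`π_j ≠ 0` valuation-independent, and `Σ_a n p a = 0` for each `p`. [folklore] -/
theorem exists_monomial_cartan {ι : Type*} [Fintype ι] [DecidableEq ι] (Γ : Fin 3 → Matrix ι ι L)
    (hΓ : ∀ p, (Γ p).det = 1) :
    ∃ (P Q : Fin 3 → Matrix ι ι O) (r : ℕ) (π : Fin r → L) (n : Fin 3 → ι → Fin r → ℤ),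
      (∀ p, (P p).det = 1) ∧ (∀ p, (Q p).det = 1) ∧ (∀ j, π j ≠ 0) ∧
      (∀ k : Fin r → ℤ, (∏ j, π j ^ k j) ∈ O → (∏ j, π j ^ k j)⁻¹ ∈ O → k = 0) ∧
      (∀ p, ∑ a, n p a = 0) ∧
      (∀ p, Γ p = (P p).map O.subtype * diagonal (fun a => ∏ j, π j ^ n p a j) *
        (Q p).map O.subtype) := by
  classical
  -- Smith normal form for each factor
  choose P Q d hP hQ hΓeq using fun p => O.exists_sl_mul_diagonal_mul_sl (Γ p)
  -- the diagonal entries are nonzero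
  have hddet : ∀ p, ∏ a, d p a = 1 := by
    intro p
    have h := congr_arg Matrix.det (hΓeq p)
    rw [hΓ p, det_mul, det_mul, det_diagonal] at h
    have hP' : ((P p).map O.subtype).det = 1 := by
      rw [← RingHom.mapMatrix_apply, ← RingHom.map_det, hP p, map_one]
    have hQ' : ((Q p).map O.subtype).det = 1 := by
      rw [← RingHom.mapMatrix_apply, ← RingHom.map_det, hQ p, map_one]
    rw [hP', hQ', one_mul, mul_one] at h
    exact h.symm
  have hd0 : ∀ pa : Fin 3 × ι, d pa.1 pa.2 ≠ 0 := fun pa h0 => by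
    have := hddet pa.1
    rw [Finset.prod_eq_zero (Finset.mem_univ pa.2) h0] at this
    exact zero_ne_one this
  -- monomial basis of the diagonal entries
  obtain ⟨r, π, n, ε, hπ, hε, hdeq, hind⟩ :=
    O.exists_monomial_basis (fun pa : Fin 3 × ι => d pa.1 pa.2) hd0
  have hε0 : ∀ pa, ε pa ≠ 0 := fun pa h0 => by
    have := hdeq pa
    rw [h0, mul_zero] at this
    exact hd0 pa this
  -- the exponents sum to zero and the units multiply to one, for each `p`
  have hsum : ∀ p, ∑ a, n (p, a) = 0 := by
    intro p
    have h1 : (∏ a, ∏ j, π j ^ n (p, a) j) * ∏ a, ε (p, a) = 1 := by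
      rw [← Finset.prod_mul_distrib, ← hddet p]
      exact Finset.prod_congr rfl fun a _ => (hdeq (p, a)).symm
    have hεO : (∏ a, ε (p, a)) ∈ O := prod_mem fun a _ => (hε (p, a)).1
    have hεO' : (∏ a, ε (p, a))⁻¹ ∈ O := by
      rw [← Finset.prod_inv_distrib]
      exact prod_mem fun a _ => (hε (p, a)).2
    refine hind _ ?_ ?_
    · simp only [Finset.sum_apply]
      rw [prod_zpow_sum π hπ]
      have : (∏ a, ∏ j, π j ^ n (p, a) j) = (∏ a, ε (p, a))⁻¹ :=
        eq_inv_of_mul_eq_one_left h1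
      rw [this]; exact hεO'
    · simp only [Finset.sum_apply]
      rw [prod_zpow_sum π hπ]
      have : (∏ a, ∏ j, π j ^ n (p, a) j)⁻¹ = ∏ a, ε (p, a) := by
        rw [eq_inv_of_mul_eq_one_left h1, inv_inv]
      rw [this]; exact hεO
  have hεprod : ∀ p, ∏ a, ε (p, a) = 1 := by
    intro p
    have h1 : (∏ a, ∏ j, π j ^ n (p, a) j) * ∏ a, ε (p, a) = 1 := by
      rw [← Finset.prod_mul_distrib, ← hddet p]
      exact Finset.prod_congr rfl fun a _ => (hdeq (p, a)).symm
    have hsum' : ∀ j, ∑ a, n (p, a) j = 0 := fun j => by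
      have := congr_fun (hsum p) j
      simpa only [Finset.sum_apply, Pi.zero_apply] using this
    have h2 : (∏ a, ∏ j, π j ^ n (p, a) j) = 1 := by
      rw [← prod_zpow_sum π hπ]
      simp only [hsum', zpow_zero, Finset.prod_const_one]
    rwa [h2, one_mul] at h1
  -- absorb the units into `Q`
  set Q' : Fin 3 → Matrix ι ι O := fun p =>
    diagonal (fun a => (⟨ε (p, a), (hε (p, a)).1⟩ : O)) * Q p with hQ'
  refine ⟨P, Q', r, π, fun p a => n (p, a), hP, fun p => ?_, hπ, hind, hsum, fun p => ?_⟩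
  · rw [hQ', det_mul, det_diagonal, hQ p, mul_one]
    apply Subtype.ext
    rw [show (((∏ a, (⟨ε (p, a), (hε (p, a)).1⟩ : O)) : O) : L) = ∏ a, ε (p, a) from
      map_prod O.subtype _ _]
    exact hεprod p
  · have hQmap : (Q' p).map O.subtype =
        diagonal (fun a => ε (p, a)) * (Q p).map O.subtype := by
      rw [hQ', Matrix.map_mul, diagonal_map (map_zero _)]
      rfl
    rw [hQmap, hΓeq p]
    simp only [Matrix.mul_assoc]
    congr 1
    rw [← Matrix.mul_assoc, diagonal_mul_diagonal]
    congr 2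
    funext a
    exact hdeq (p, a)

/-! ### Integer weights with prescribed signs -/

/-- A monomial not in `O` has its inverse in the maximal ideal; a monomial in `O` whose inverse is
not has itself valuation `< 1`. Both facts in the form: `x ∉ O → v x⁻¹ < 1`. [folklore] -/
theorem valuation_inv_lt_one_of_not_mem {x : L} (hx : x ∉ O) : O.valuation x⁻¹ < 1 := by
  have hx0 : x ≠ 0 := fun h => hx (h ▸ O.zero_mem)
  rw [map_inv₀, inv_lt_one₀ (zero_lt_iff.mpr ((Valuation.ne_zero_iff _).mpr hx0))]
  exact lt_of_not_ge fun h => hx ((O.valuation_le_one_iff x).mp h)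

/-- **Sign-exact integer weights** (Gordan's alternative in the value group): for nonzero
`π₁, …, π_r` and finitely many exponent vectors `E_c`, some `h ∈ ℤ^r` has
`⟨h, E_c⟩ < 0` when `π^{E_c} ∉ O` and `⟨h, E_c⟩ > 0` when `π^{E_c}` is a non-unit of `O`.
[folklore] -/
theorem exists_sign_weights {r : ℕ} (π : Fin r → L) (hπ : ∀ j, π j ≠ 0)
    {C : Type*} [Fintype C] (E : C → Fin r → ℤ) :
    ∃ h : Fin r → ℤ, ∀ c,
      ((∏ j, π j ^ E c j) ∉ O → ∑ j, h j * E c j < 0) ∧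
      ((∏ j, π j ^ E c j) ∈ O → (∏ j, π j ^ E c j)⁻¹ ∉ O → 0 < ∑ j, h j * E c j) := by
  classical
  -- the relevant vectors, signed
  set Pos := {c // (∏ j, π j ^ E c j) ∈ O ∧ (∏ j, π j ^ E c j)⁻¹ ∉ O} with hPos
  set Neg := {c // (∏ j, π j ^ E c j) ∉ O} with hNeg
  set f : Pos ⊕ Neg → Fin r → ℤ := fun b => match b with
    | Sum.inl c => E c
    | Sum.inr c => -E c with hf
  rcases Literature.Combinatorics.Optimization.gordan_int r f with ⟨h, hh⟩ | ⟨cf, ⟨b₀, hb₀⟩, hrel⟩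
  · refine ⟨h, fun c => ⟨fun hc => ?_, fun hc hc' => ?_⟩⟩
    · have := hh (Sum.inr ⟨c, hc⟩)
      simp only [hf, Pi.neg_apply, mul_neg, Finset.sum_neg_distrib] at this
      linarith
    · have := hh (Sum.inl ⟨c, hc, hc'⟩)
      simpa only [hf] using this
  · -- a nonnegative relation is impossible: `1 = ∏ (π^{f_b})^{c_b}` would lie in `𝔪_O`
    exfalso
    -- the monomials `π^{f_b}` have valuation `< 1`
    have hlt : ∀ b, O.valuation (∏ j, π j ^ f b j) < 1 := by
      rintro (c | c)
      · -- non-unit of `O`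
        obtain ⟨hc, hc'⟩ := c.2
        have := valuation_inv_lt_one_of_not_mem O hc'
        rwa [inv_inv] at this
      · have := valuation_inv_lt_one_of_not_mem O c.2
        simp only [hf]
        convert this using 2
        rw [← Finset.prod_inv_distrib]
        exact Finset.prod_congr rfl fun j _ => by rw [Pi.neg_apply, _root_.zpow_neg]
    have hle : ∀ b, O.valuation ((∏ j, π j ^ f b j) ^ cf b) ≤ 1 := fun b => by
      rw [map_pow]
      exact pow_le_one₀ zero_le (le_of_lt (hlt b))
    -- the relation says the product of all of them is `1`
    have hone : ∏ b, (∏ j, π j ^ f b j) ^ cf b = 1 := by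
      have : ∀ b, (∏ j, π j ^ f b j) ^ cf b = ∏ j, π j ^ ((cf b : ℤ) * f b j) := fun b => by
        rw [← zpow_natCast, ← Finset.prod_zpow]
        exact Finset.prod_congr rfl fun j _ => by rw [← _root_.zpow_mul, mul_comm]
      simp_rw [this]
      rw [← prod_zpow_sum π hπ]
      have hzero : (fun j => ∑ b, (cf b : ℤ) * f b j) = 0 := funext fun j => hrel j
      rw [show (∏ j, π j ^ ∑ b, (cf b : ℤ) * f b j) = ∏ j, π j ^ (0 : Fin r → ℤ) j from
        Finset.prod_congr rfl fun j _ => by rw [← hzero]]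
      simp
    -- but the factor `b₀` already makes it `< 1`
    have hlt₀ : O.valuation ((∏ j, π j ^ f b₀ j) ^ cf b₀) < 1 := by
      rw [map_pow]
      exact pow_lt_one₀ zero_le (hlt b₀) (Nat.pos_iff_ne_zero.mp hb₀)
    have : O.valuation (∏ b, (∏ j, π j ^ f b j) ^ cf b) < 1 := by
      rw [map_prod, ← Finset.mul_prod_erase _ _ (Finset.mem_univ b₀)]
      exact mul_lt_one_of_lt_of_le hlt₀ (Finset.prod_le_one' fun b _ => hle b)
    rw [hone, map_one] at this
    exact lt_irrefl _ this

end Literature.RepresentationTheory.AlgebraicGroups
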